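import Summits.ResolutionOfSingularities.ResolutionOfSingularities.Theorems.WeightedInvariantHypersurfaceCentreAssemblyTorusStalk
import Summits.ResolutionOfSingularities.ResolutionOfSingularities.Theorems.WeightedInvariantHypersurfaceCentreAssemblyMaxLocus
import HarnessLib

/-!
# Door assembly H2c″ — [S6] TORUS HALF: over a point off the centre, `ι` on the successor stays below `ι_max`

Route `ResolutionOfSingularities/WeightedInvariant`, crux `Theses.WeightedInvariant.HypersurfaceCentreConstruction`
(stmt-ResolutionOfSingularities-19897), door line `local-engine`, skeleton v3.4, assembly stub **[S6]** `stub_iotaMax_lt_of_step`;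
plan of record `D/res-D-brk-1/S6-PLAN.md` (res-L1-w43-stub-9; CHAIN v4.10 deal: res-type-089 = K4-E `…AssemblyPlusStalk`,
stub-9 = exceptional half + composition, res-type-057 = TORUS HALF).

**`iotaAt_lt_iotaMax_of_not_mem_maxLocus_of_stalkChain`** — the torus half in POST-STALK-CHAIN form, with the successor
ABSTRACTED.  Data: the pair `(f : Y → Spec k, X)` with `Y` smooth, `X` locally principal; a canonical centre `R`
(`IsCanonicalCentre ι J X R`); an affine `U` and an ideal filtration `Fch` of `Γ(Y,U)` whose members are the sections `𝒥ₙ(U)` of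
the centre's pieces (for [S6]: `Fch = R′.filtration U`); a point `y ∈ U` with `y ∉ maxLocus ι X`; ANY scheme `Y′` with a locally
principal ideal sheaf `K′` and a point `y′` (for [S6]: `Y′ = B₊ = R′.plus`, `K′ = σˢ(X)|_{B₊}`, `y = π₊ y′`); and the K4-E STALK
CHAIN at `y′` over `U` — a prime `𝔫` of `⊕ₙ 𝒥ₙ(U) tⁿ = Fch.extendedRees` with a ring isomorphism `Ψ₁ : 𝒪_{Y′,y′} ≃ (Fch.extendedRees)_𝔫`
carrying the stalk `K′_{y′}` onto the saturation `⋃ₙ (X(U)·(…)_𝔫 : (t⁻¹/1)ⁿ)` (I) and with `𝔫 ∩ Γ(Y,U) = 𝔮_y` (II).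
Conclusion: if `y′` is a NON-regular point of `K′` then `iotaAt ι K′ y′ < iotaMax ι X`.

Proof (S6-PLAN, TORUS CASE), split as a RING-LEVEL CORE `iota_le_of_stalkChain_of_forall_map_eq_top` plus a thin
scheme-level wrapper: off the maximum locus every piece of the centre has stalk `⊤` at `y`
(`IsCanonicalCentre.stalkIdeal_eq_top`), so over `A′ = 𝒪_{Y,y}` (the localisation of `Γ(Y,U)` at `𝔮_y`,
`IsAffineOpen.isLocalization_stalk`; regular since `Y` is smooth over a field) the game-side filtration `I′ₙ = 𝒥ₙ(U)·A′` is
TRIVIAL; res-type-048's package (`exists_prime_extReesAlgebra_ringEquiv_localization_T`, p509387) moves `(⊕𝒥ₙ(U)tⁿ)_𝔫` to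
`O′ = (extReesAlgebra I′)_{𝔫′}` over `A′` with `𝔫′` over `𝔪_{A′}` and `t⁻¹ ↦ t⁻¹`; there `t⁻¹` is a unit, the saturation is
`(f₀/1)` for the local equation `f₀ = localGenerator X y ∈ A′`, and the torus-stalk package (`…AssemblyTorusStalk`, p511154)
gives `ι(O′, γ) ≤ ι(A′, f₀) = iotaAt ι X y` and `γ ∈ 𝔪_{O′}² ⇒ f₀ ∈ 𝔪_{A′}²`, `γ ≠ 0 ⇒ f₀ ≠ 0`, i.e. `y ∈ singImage X`
(point dictionary, p505376); finally `iotaAt ι X y < iotaMax ι X` off the maximum locus (p504597).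

**`iotaAt_lt_iotaMax_of_not_mem_maxLocus_of_readOff`** — the same conclusion in POST-READ-OFF form, consuming the
conjuncts of K4-E's point read-off `exists_gameSide_readOff` (res-type-089, `…AssemblyPlusStalk`, signatures of
08:13Z) VERBATIM over `A′ := Localization.AtPrime (U.2.primeIdealOf ⟨y, _⟩).asIdeal`: this is the form the [S6]
composition (stub-9) calls in the case `π₊ y′ ∉ maxLocus ι X`.

The composition of [S6] calls one of these after ONE chart reduction + K4-E (shared with the exceptional half).  The clauses are
HYPOTHESES on an arbitrary `ι`; nothing about Hironaka's problem is claimed.  AI-written; weaker than expert review.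
-/

noncomputable section

set_option linter.dupNamespace false -- mandated namespace of this single-conjunct summit

open CategoryTheory AlgebraicGeometry TopologicalSpace IsLocalRing
open scoped LaurentPolynomial
open Literature.AlgebraicGeometry.Resolution
open Summit.ResolutionOfSingularities.ResolutionOfSingularities.Theorems

namespace Summit.ResolutionOfSingularities.ResolutionOfSingularities.Cruxes.HypersurfaceCentreConstruction.LocalEngine

/-! ## Generic lemmas -/

section Generic

/-- An ideal whose extension along a ring isomorphism is `⊤` is `⊤`. [folklore] -/
theorem eq_top_of_map_ringEquiv_eq_top {R R' : Type*} [CommRing R] [CommRing R'] (e : R ≃+* R') {I : Ideal R}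
    (h : I.map (e : R →+* R') = ⊤) : I = ⊤ := by
  rw [← Ideal.comap_map_of_bijective (e : R →+* R') e.bijective (I := I), h, Ideal.comap_top]

/-- A prime of an algebra over a local ring containing the extension of the maximal ideal lies over the maximal ideal.
[folklore] -/
theorem comap_eq_maximalIdeal_of_map_le {A' C : Type*} [CommRing A'] [IsLocalRing A'] [CommRing C] [Algebra A' C]
    (𝔫 : Ideal C) [𝔫.IsPrime] (h : (maximalIdeal A').map (algebraMap A' C) ≤ 𝔫) :
    𝔫.comap (algebraMap A' C) = maximalIdeal A' :=
  ((IsLocalRing.maximalIdeal.isMaximal A').eq_of_le (Ideal.IsPrime.ne_top inferInstance)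
    (Ideal.map_le_iff_le_comap.mp h)).symm

/-- The localised trivial extended Rees algebra over a regular local ring is a regular local ring (torus stalk `(S[T;T⁻¹])_𝔔`,
regularity ascent p506893). [folklore] -/
theorem isRegularLocalRing_localization_extRees_top {S : Type} [CommRing S] [IsRegularLocalRing S] {I : ℕ → Ideal S}
    (hI : ∀ n, I n = ⊤) (𝔫 : Ideal (extReesAlgebra I)) [𝔫.IsPrime]
    (h𝔫 : 𝔫.comap (algebraMap S (extReesAlgebra I)) = maximalIdeal S) : IsRegularLocalRing (Localization.AtPrime 𝔫) := by
  obtain ⟨𝔔, h𝔔, hcomap, Θ, -⟩ := exists_ringEquiv_localization_laurent_of_forall_eq_top hI 𝔫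
  rw [h𝔫] at hcomap
  let e₀ : S ≃ₐ[S] Localization.AtPrime (maximalIdeal S) :=
    IsLocalization.atUnits S (maximalIdeal S).primeCompl (S := Localization.AtPrime (maximalIdeal S))
      (fun x hx => (IsLocalRing.notMem_maximalIdeal.mp hx))
  haveI : IsRegularLocalRing (Localization.AtPrime (maximalIdeal S)) :=
    @IsRegularLocalRing.of_ringEquiv S _ ‹_› _ _ e₀.toRingEquiv
  haveI := isRegularLocalRing_localization_laurent (maximalIdeal S) 𝔔 hcomap
  exact @IsRegularLocalRing.of_ringEquiv (Localization.AtPrime 𝔔) _ ‹_› _ _ Θ.symm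

end Generic

/-! ## The torus core (ring level) -/

section Core

variable (ι : (R : Type) → [CommRing R] → R → Ordinal.{0})

/-- **[S6], TORUS CORE (ring level).**  `A′` a regular local ring, the localisation of `A` at a prime `𝔮`; `Fch` an ideal
filtration of `A` all of whose members extend to `⊤` in `A′`; `𝔫` a prime of `Fch.extendedRees = ⊕ₙ Fchₙ tⁿ` over `𝔮`;
`K` an ideal of `A` with `K·A′ = (f₀)`; and a local ring `O₁` with `Ψ₁ : O₁ ≃ (Fch.extendedRees)_𝔫` carrying `I₁ = (γ₀)` onto the
saturation `⋃ₙ (K·(…)_𝔫 : (t⁻¹/1)ⁿ)`.  THEN `(Fch.extendedRees)_𝔫` is a regular local ring, `ι(O₁, γ₀) ≤ ι(A′, f₀)`,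
`γ₀ ∈ 𝔪_{O₁}² ⇒ f₀ ∈ 𝔪_{A′}²`, and `γ₀ ≠ 0 ⇒ f₀ ≠ 0`.  Proof: res-type-048's package moves `(Fch.extendedRees)_𝔫` to
`O′ = (extReesAlgebra I′)_{𝔫′}`, `I′ₙ = Fchₙ·A′ = ⊤`, with `𝔫′` over `𝔪_{A′}` and `t⁻¹ ↦ t⁻¹`; there the torus-stalk package
(p511154) applies ((c6), (c10), (c12a)). [folklore] -/
theorem iota_le_of_stalkChain_of_forall_map_eq_top
    (hc6 : IotaIsoInvariant ι) (hc10 : IotaTorusFactorMonotone ι) (hu : IotaUnitInvariant ι)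
    {A : Type} [CommRing A] (𝔮 : Ideal A) [𝔮.IsPrime] {A' : Type} [CommRing A'] [Algebra A A']
    [IsLocalization.AtPrime A' 𝔮] [IsRegularLocalRing A']
    (Fch : IdealFiltration A) (htop : ∀ n, (Fch.ideal n).map (algebraMap A A') = ⊤)
    (𝔫 : Ideal Fch.extendedRees) [𝔫.IsPrime] (hII : 𝔫.comap (algebraMap A Fch.extendedRees) = 𝔮)
    {K : Ideal A} {f₀ : A'} (hf₀ : K.map (algebraMap A A') = Ideal.span {f₀})
    {O₁ : Type} [CommRing O₁] [IsLocalRing O₁] (Ψ₁ : O₁ ≃+* Localization.AtPrime 𝔫) {I₁ : Ideal O₁} {γ₀ : O₁}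
    (hI₁ : I₁ = Ideal.span {γ₀})
    (hI : I₁.map (Ψ₁ : O₁ →+* Localization.AtPrime 𝔫) =
      ⨆ n : ℕ, (K.map (algebraMap A (Localization.AtPrime 𝔫))).colon
        {algebraMap Fch.extendedRees (Localization.AtPrime 𝔫) ⟨LaurentPolynomial.T (-1), Fch.T_neg_one_mem_extendedRees⟩ ^ n}) :
    IsRegularLocalRing (Localization.AtPrime 𝔫) ∧ ι O₁ γ₀ ≤ ι A' f₀ ∧
      (γ₀ ∈ maximalIdeal O₁ ^ 2 → f₀ ∈ maximalIdeal A' ^ 2) ∧ (γ₀ ≠ 0 → f₀ ≠ 0) := by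
  haveI : IsDomain A' := isDomain_of_isRegularLocalRing A'
  -- the game-side model at `𝔫`: res-type-048's package
  have hd : Disjoint ((𝔮.primeCompl.map (algebraMap A Fch.extendedRees) : Submonoid Fch.extendedRees) :
      Set Fch.extendedRees) (𝔫 : Set Fch.extendedRees) := by
    rw [Set.disjoint_left]
    rintro _ ⟨a, ha, rfl⟩ hmem
    have : a ∈ 𝔫.comap (algebraMap A Fch.extendedRees) := hmem
    rw [hII] at this
    exact ha this
  obtain ⟨𝔫', h𝔫'p, g, hi, -, -, hiv, hv⟩ :=
    exists_prime_extReesAlgebra_ringEquiv_localization_T Fch 𝔮.primeCompl (A' := A')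
      (I' := fun n => (Fch.ideal n).map (algebraMap A A')) (fun _ => rfl) 𝔫 hd
  -- `𝔫′` lies over `𝔪_{A′}`
  have h𝔫' : 𝔫'.comap (algebraMap A' _) = maximalIdeal A' := by
    apply comap_eq_maximalIdeal_of_map_le
    have hle : 𝔮.map (algebraMap A Fch.extendedRees) ≤ 𝔫 := Ideal.map_le_iff_le_comap.mpr hII.ge
    have h := (hiv _).mpr hle
    rwa [IsLocalization.AtPrime.map_eq_maximalIdeal 𝔮 A'] at h
  -- regularity and integrality of `O′ := (extReesAlgebra I′)_{𝔫′}`, hence of `(Fch.extendedRees)_𝔫`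
  haveI hregO' : IsRegularLocalRing (Localization.AtPrime 𝔫') :=
    isRegularLocalRing_localization_extRees_top htop 𝔫' h𝔫'
  haveI : IsDomain (Localization.AtPrime 𝔫') := isDomain_localization_extReesAlgebra 𝔫'
  have hreg : IsRegularLocalRing (Localization.AtPrime 𝔫) :=
    @IsRegularLocalRing.of_ringEquiv (Localization.AtPrime 𝔫') _ hregO' _ _ g.symm
  -- the saturation identity, moved to `O′` along `g`
  have hcomp : (g : _ →+* Localization.AtPrime 𝔫').comp (algebraMap A (Localization.AtPrime 𝔫)) =
      (algebraMap A' (Localization.AtPrime 𝔫')).comp (algebraMap A A') := by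
    ext a
    rw [RingHom.comp_apply, RingHom.comp_apply, RingHom.coe_coe,
      IsScalarTower.algebraMap_apply A Fch.extendedRees (Localization.AtPrime 𝔫),
      IsScalarTower.algebraMap_apply A' (extReesAlgebra fun n => (Fch.ideal n).map (algebraMap A A'))
        (Localization.AtPrime 𝔫')]
    exact hi a
  have hγSat : Ideal.span {g (Ψ₁ γ₀)} =
      ⨆ n : ℕ, (Ideal.span {algebraMap A' (Localization.AtPrime 𝔫') f₀}).colon
        {algebraMap _ (Localization.AtPrime 𝔫') (extReesAlgebra.tInv fun n => (Fch.ideal n).map (algebraMap A A')) ^ n} := by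
    have h1 : (I₁.map (Ψ₁ : O₁ →+* Localization.AtPrime 𝔫)).map (g : _ →+* Localization.AtPrime 𝔫') =
        Ideal.span {g (Ψ₁ γ₀)} := by
      rw [hI₁, Ideal.map_span, Set.image_singleton, Ideal.map_span, Set.image_singleton, RingHom.coe_coe, RingHom.coe_coe]
    have hJ : (K.map (algebraMap A (Localization.AtPrime 𝔫))).map (g : _ →+* Localization.AtPrime 𝔫') =
        Ideal.span {algebraMap A' (Localization.AtPrime 𝔫') f₀} := by
      rw [Ideal.map_map, hcomp, ← Ideal.map_map, hf₀, Ideal.map_span, Set.image_singleton]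
    rw [← h1, hI, map_iSup_colon_singleton_pow_of_ringEquiv (S := Localization.AtPrime 𝔫)
      (S' := Localization.AtPrime 𝔫') g _ _ hJ _ _ hv]
  refine ⟨hreg, ?_, ?_, ?_⟩
  · have e1 := hc6 O₁ (Localization.AtPrime 𝔫) Ψ₁ γ₀
    have e2 := hc6 (Localization.AtPrime 𝔫) (Localization.AtPrime 𝔫') g (Ψ₁ γ₀)
    calc ι O₁ γ₀ = ι (Localization.AtPrime 𝔫') (g (Ψ₁ γ₀)) := (e2.trans e1).symm
      _ ≤ ι A' f₀ := iota_le_of_span_eq_saturation_of_forall_eq_top ι hc6 hc10 hu htop 𝔫' h𝔫' _ hγSat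
  · intro hγ2
    have hγ2₁ : Ψ₁ γ₀ ∈ maximalIdeal (Localization.AtPrime 𝔫) ^ 2 :=
      (mem_pow_maximalIdeal_iff_map_ringEquiv (R := O₁) (R' := Localization.AtPrime 𝔫) Ψ₁ γ₀ 2).mp hγ2
    have hγ2' : g (Ψ₁ γ₀) ∈ maximalIdeal (Localization.AtPrime 𝔫') ^ 2 :=
      (mem_pow_maximalIdeal_iff_map_ringEquiv (R := Localization.AtPrime 𝔫) (R' := Localization.AtPrime 𝔫')
        g (Ψ₁ γ₀) 2).mp hγ2₁
    exact mem_sq_of_span_eq_saturation_of_forall_eq_top htop 𝔫' h𝔫' hγSat hγ2'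
  · intro hne h0
    apply hne
    have hunit : IsUnit (algebraMap _ (Localization.AtPrime 𝔫')
        (extReesAlgebra.tInv fun n => (Fch.ideal n).map (algebraMap A A'))) :=
      (isUnit_tInv_of_forall_eq_top htop).map
        (algebraMap (extReesAlgebra fun n => (Fch.ideal n).map (algebraMap A A')) (Localization.AtPrime 𝔫'))
    have h1 : Ideal.span {g (Ψ₁ γ₀)} = ⊥ := by
      rw [hγSat, h0, map_zero, iSup_colon_singleton_pow_eq_of_isUnit (O := Localization.AtPrime 𝔫') _ hunit,
        Ideal.span_singleton_eq_bot]
    have h2 : Ψ₁ γ₀ = 0 := g.injective ((Ideal.span_singleton_eq_bot.mp h1).trans (map_zero g).symm)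
    exact Ψ₁.injective (h2.trans (map_zero Ψ₁).symm)

end Core

/-! ## The torus half -/

section Torus

variable (ι : (R : Type) → [CommRing R] → R → Ordinal.{0})
  (J : (R : Type) → [CommRing R] → R → ℕ → Ideal R)

/-- **[S6], TORUS HALF (post-stalk-chain form).**  See the module docstring.  The successor is ABSTRACTED: `Y′` is any
scheme with a locally principal ideal sheaf `K′` and a point `y′` (for [S6]: `Y′ = B₊ = R′.plus`, `K′ = σˢ(X)|_{B₊}`,
`y = π₊ y′`), `Fch` is any ideal filtration of `Γ(Y,U)` with the sections of the centre's pieces as its members (for [S6]: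
`Fch = R′.filtration U`, by `ReesFiltration.filtration_ideal` and `R′.ideal = R.piece`), and `𝔫`, `Ψ₁`, `hI`, `hII` are
exactly what the K4-E stalk chain (`…AssemblyPlusStalk`) delivers at `y′` over the affine `U ∋ y`.  Proof: the torus core
over `A′ = 𝒪_{Y,y}` (the localisation of `Γ(Y,U)` at `𝔮_y`, regular since `Y` is smooth over a field), where the centre's
pieces have stalk `⊤` off the maximum locus (`IsCanonicalCentre.stalkIdeal_eq_top`); then the point dictionary
(`iotaAt`, `singImage` via the local equation, p505376) and `iotaAt ι X y < iotaMax ι X` off the maximum locus (p504597).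
[folklore] -/
theorem iotaAt_lt_iotaMax_of_not_mem_maxLocus_of_stalkChain
    (hc6 : IotaIsoInvariant ι) (hc10 : IotaTorusFactorMonotone ι) (hu : IotaUnitInvariant ι)
    {k : Type} [Field k] {Y : Scheme.{0}} (f : Y ⟶ Spec (.of k)) [Smooth f]
    (X : Y.IdealSheafData) (hX : IsLocallyPrincipal X) {R : ReesAlgebraData Y} (hR : IsCanonicalCentre ι J X R)
    (U : Y.affineOpens) (Fch : IdealFiltration Γ(Y, U)) (hFch : ∀ n, Fch.ideal n = (R.piece n).ideal U)
    (y : Y) (hyU : y ∈ (U : Y.Opens)) (hy : y ∉ maxLocus ι X)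
    {Y' : Scheme.{0}} (K' : Y'.IdealSheafData) (hlp' : IsLocallyPrincipal K') (y' : Y')
    (𝔫 : Ideal Fch.extendedRees) [𝔫.IsPrime] (Ψ₁ : Y'.presheaf.stalk y' ≃+* Localization.AtPrime 𝔫)
    (hI : (stalkIdeal K' y').map (Ψ₁ : Y'.presheaf.stalk y' →+* Localization.AtPrime 𝔫) =
      ⨆ n : ℕ, ((X.ideal U).map (algebraMap Γ(Y, U) (Localization.AtPrime 𝔫))).colon
        {algebraMap Fch.extendedRees (Localization.AtPrime 𝔫) ⟨LaurentPolynomial.T (-1), Fch.T_neg_one_mem_extendedRees⟩ ^ n})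
    (hII : 𝔫.comap (algebraMap Γ(Y, U) Fch.extendedRees) = (U.2.primeIdealOf ⟨y, hyU⟩).asIdeal)
    (hy' : y' ∈ singImage K') :
    iotaAt ι K' y' < iotaMax ι X := by
  -- `A′ := 𝒪_{Y,y}` as the localisation of `Γ(Y,U)` at `𝔮_y`; it is a regular local ring
  letI : Algebra Γ(Y, U) (Y.presheaf.stalk y) :=
    TopCat.Presheaf.algebra_section_stalk Y.presheaf (⟨y, hyU⟩ : (U : Y.Opens))
  haveI : IsLocalization.AtPrime (Y.presheaf.stalk y) (U.2.primeIdealOf ⟨y, hyU⟩).asIdeal :=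
    U.2.isLocalization_stalk ⟨y, hyU⟩
  haveI : (U.2.primeIdealOf ⟨y, hyU⟩).asIdeal.IsPrime := (U.2.primeIdealOf ⟨y, hyU⟩).isPrime
  haveI : IsRegularLocalRing (Y.presheaf.stalk y) := isRegularLocalRing_stalk_of_smooth_of_field f _
  have halg : algebraMap Γ(Y, U) (Y.presheaf.stalk y) = (Y.presheaf.germ U y hyU).hom := rfl
  -- TORUS: off the maximum locus the centre's filtration is trivial at `y`
  have htop : ∀ n, (Fch.ideal n).map (algebraMap Γ(Y, U) (Y.presheaf.stalk y)) = ⊤ := by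
    intro n
    rw [halg, hFch n, ← stalkIdeal_eq_map_germ (R.piece n) U hyU]
    exact hR.stalkIdeal_eq_top _ hy n
  -- local equations
  have hK' : ∃ g₀, stalkIdeal K' y' = Ideal.span {g₀} := (hlp' y').isPrincipal_stalkIdeal.principal
  have hK : ∃ g₀, stalkIdeal X y = Ideal.span {g₀} := (hX _).isPrincipal_stalkIdeal.principal
  have hst' := stalkIdeal_eq_span_localGenerator K' y' hK'
  have hst := stalkIdeal_eq_span_localGenerator X y hK
  have hf₀ : (X.ideal U).map (algebraMap Γ(Y, U) (Y.presheaf.stalk y)) = Ideal.span {localGenerator X y} := by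
    rw [halg, ← stalkIdeal_eq_map_germ X U hyU, hst]
  -- the torus core
  obtain ⟨hreg, hle, hsq, hne⟩ := iota_le_of_stalkChain_of_forall_map_eq_top ι hc6 hc10 hu
    (U.2.primeIdealOf ⟨y, hyU⟩).asIdeal Fch htop 𝔫 hII hf₀ Ψ₁ hst' hI
  haveI : IsRegularLocalRing (Y'.presheaf.stalk y') :=
    @IsRegularLocalRing.of_ringEquiv (Localization.AtPrime 𝔫) _ hreg _ _ Ψ₁.symm
  -- read-offs: `y′ ∈ singImage K′` gives `γ₀ ≠ 0`, `γ₀ ∈ 𝔪²`; hence `f₀ ≠ 0`, `f₀ ∈ 𝔪²`, i.e. `y ∈ singImage X`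
  have hg0' : localGenerator K' y' ≠ 0 := ne_zero_of_mem_singImage_of_stalkIdeal_eq K' hst' hy'
  have hγ2 : localGenerator K' y' ∈ maximalIdeal (Y'.presheaf.stalk y') ^ 2 :=
    (mem_singImage_iff_mem_sq_of_stalkIdeal_eq K' hst' hg0').mp hy'
  have hysing : y ∈ singImage X := (mem_singImage_iff_mem_sq_of_stalkIdeal_eq X hst (hne hg0')).mpr (hsq hγ2)
  -- conclude
  calc iotaAt ι K' y' = ι (Y'.presheaf.stalk y') (localGenerator K' y') := rfl
    _ ≤ ι (Y.presheaf.stalk y) (localGenerator X y) := hle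
    _ = iotaAt ι X y := rfl
    _ < iotaMax ι X := iotaAt_lt_iotaMax_of_not_mem_maxLocus ι X hysing hy

/-- **[S6], TORUS HALF (post-read-off form)** — consumes K4-E's point read-off `exists_gameSide_readOff` (res-type-089,
`…AssemblyPlusStalk`) VERBATIM: over `A′ := Γ(Y,U)_{𝔮_y}` (`Localization.AtPrime (U.2.primeIdealOf ⟨y, _⟩).asIdeal`) with
the localised pieces `I′ₙ = 𝒥ₙ(U)·A′` of the centre, a prime `𝔫′` of `extReesAlgebra I′` over `𝔪_{A′}` (`h𝔫′`), a model
`Ψ : 𝒪_{Y′,y′} ≃ O′ := (extReesAlgebra I′)_{𝔫′}` with `O′` regular, carrying `K′_{y′}` onto `(γ)` = the `t⁻¹`-saturation of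
`(F/1)` (`X(U) = (F)`), `iotaAt ι K′ y′ = ι(O′, γ)` and `γ ∈ 𝔪_{O′}²` (the read-off at a point `y′ ∈ singImage K′`).  If
`y ∉ maxLocus ι X` then `iotaAt ι K′ y′ < iotaMax ι X`.  For [S6]: `Y′ = B₊`, `K′ = σˢ(X)|_{B₊}`, `y = π₊ y′`,
`I′ₙ = (R′.ideal n)(U)·A′` with `R′.ideal = R.piece`.  Proof: `I′ₙ = ⊤` off the maximum locus
(`IsCanonicalCentre.stalkIdeal_eq_top` through `stalkEquiv`), the torus-stalk package (p511154) gives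
`ι(O′, γ) ≤ ι(A′, F/1) = iotaAt ι X y` (`iotaAt_eq_iota_localization`, p505376) and `F/1 ∈ 𝔪_{A′}²`, `F/1 ≠ 0`, i.e.
`y ∈ singImage X`; conclude by `iotaAt ι X y < iotaMax ι X` (p504597). [folklore] -/
theorem iotaAt_lt_iotaMax_of_not_mem_maxLocus_of_readOff
    (hc6 : IotaIsoInvariant ι) (hc10 : IotaTorusFactorMonotone ι) (hu : IotaUnitInvariant ι)
    {k : Type} [Field k] {Y : Scheme.{0}} (f : Y ⟶ Spec (.of k)) [Smooth f]
    (X : Y.IdealSheafData) {R : ReesAlgebraData Y} (hR : IsCanonicalCentre ι J X R)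
    (U : Y.affineOpens) {F : Γ(Y, U)} (hF : X.ideal U = Ideal.span {F})
    (y : Y) (hyU : y ∈ (U : Y.Opens)) (hy : y ∉ maxLocus ι X)
    {I' : ℕ → Ideal (Localization.AtPrime (U.2.primeIdealOf ⟨y, hyU⟩).asIdeal)}
    (hI' : ∀ n, I' n = ((R.piece n).ideal U).map
      (algebraMap Γ(Y, U) (Localization.AtPrime (U.2.primeIdealOf ⟨y, hyU⟩).asIdeal)))
    {Y' : Scheme.{0}} (K' : Y'.IdealSheafData) (y' : Y') (hy' : y' ∈ singImage K')
    (𝔫' : Ideal (extReesAlgebra I')) [𝔫'.IsPrime]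
    (Ψ : Y'.presheaf.stalk y' ≃+* Localization.AtPrime 𝔫') (γ : Localization.AtPrime 𝔫')
    (hreg : IsRegularLocalRing (Localization.AtPrime 𝔫'))
    (hγΨ : (stalkIdeal K' y').map (Ψ : Y'.presheaf.stalk y' →+* Localization.AtPrime 𝔫') = Ideal.span {γ})
    (hγ : Ideal.span {γ} = ⨆ n : ℕ, (Ideal.span {algebraMap (extReesAlgebra I') (Localization.AtPrime 𝔫')
        (algebraMap _ (extReesAlgebra I') (algebraMap Γ(Y, U)
          (Localization.AtPrime (U.2.primeIdealOf ⟨y, hyU⟩).asIdeal) F))}).colon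
        {algebraMap (extReesAlgebra I') (Localization.AtPrime 𝔫') (extReesAlgebra.tInv I') ^ n})
    (hιy' : iotaAt ι K' y' = ι (Localization.AtPrime 𝔫') γ)
    (hγ2 : γ ∈ maximalIdeal (Localization.AtPrime 𝔫') ^ 2)
    (h𝔫' : (maximalIdeal (Localization.AtPrime (U.2.primeIdealOf ⟨y, hyU⟩).asIdeal)).map
      (algebraMap _ (extReesAlgebra I')) ≤ 𝔫') :
    iotaAt ι K' y' < iotaMax ι X := by
  haveI h𝔮p : (U.2.primeIdealOf ⟨y, hyU⟩).asIdeal.IsPrime := (U.2.primeIdealOf ⟨y, hyU⟩).isPrime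
  haveI : IsRegularLocalRing (Y.presheaf.stalk y) := isRegularLocalRing_stalk_of_smooth_of_field f _
  haveI hregA' : IsRegularLocalRing (Localization.AtPrime (U.2.primeIdealOf ⟨y, hyU⟩).asIdeal) :=
    IsRegularLocalRing.of_ringEquiv (stalkEquiv U hyU).symm
  haveI : IsRegularLocalRing (Y'.presheaf.stalk y') :=
    @IsRegularLocalRing.of_ringEquiv (Localization.AtPrime 𝔫') _ hreg _ _ Ψ.symm
  -- TORUS: the localised pieces are trivial off the maximum locus
  have htop : ∀ n, I' n = ⊤ := by
    intro n
    have h1 : (I' n).map (stalkEquiv U hyU : _ →+* Y.presheaf.stalk y) = ⊤ := by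
      rw [hI' n, map_stalkEquiv_map, ← stalkIdeal_eq_map_germ (R.piece n) U hyU]
      exact hR.stalkIdeal_eq_top _ hy n
    exact eq_top_of_map_ringEquiv_eq_top (stalkEquiv U hyU) h1
  -- `𝔫′` lies over `𝔪_{A′}`
  have h𝔫 : 𝔫'.comap (algebraMap (Localization.AtPrime (U.2.primeIdealOf ⟨y, hyU⟩).asIdeal) (extReesAlgebra I')) =
      maximalIdeal _ := comap_eq_maximalIdeal_of_map_le 𝔫' h𝔫'
  -- the saturation identity with `f₀/1`, `f₀ := F/1 ∈ A′`
  have key : algebraMap (extReesAlgebra I') (Localization.AtPrime 𝔫') (algebraMap _ (extReesAlgebra I')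
      (algebraMap Γ(Y, U) (Localization.AtPrime (U.2.primeIdealOf ⟨y, hyU⟩).asIdeal) F)) =
      algebraMap (Localization.AtPrime (U.2.primeIdealOf ⟨y, hyU⟩).asIdeal) (Localization.AtPrime 𝔫')
        (algebraMap Γ(Y, U) (Localization.AtPrime (U.2.primeIdealOf ⟨y, hyU⟩).asIdeal) F) :=
    (IsScalarTower.algebraMap_apply (Localization.AtPrime (U.2.primeIdealOf ⟨y, hyU⟩).asIdeal) (extReesAlgebra I')
      (Localization.AtPrime 𝔫') _).symm
  have hγ' := hγ
  simp only [key] at hγ'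
  -- the torus-stalk package
  have hle := iota_le_of_span_eq_saturation_of_forall_eq_top ι hc6 hc10 hu htop 𝔫' h𝔫 _ hγ'
  have hf₀2 := mem_sq_of_span_eq_saturation_of_forall_eq_top htop 𝔫' h𝔫 hγ' hγ2
  -- `γ ≠ 0` (as `y′ ∈ singImage K′`), hence `F/1 ≠ 0`
  have hunit : IsUnit (algebraMap (extReesAlgebra I') (Localization.AtPrime 𝔫') (extReesAlgebra.tInv I')) :=
    (isUnit_tInv_of_forall_eq_top htop).map (algebraMap (extReesAlgebra I') (Localization.AtPrime 𝔫'))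
  have hγ0 : γ ≠ 0 := by
    rintro rfl
    have hb : (stalkIdeal K' y').map (Ψ : Y'.presheaf.stalk y' →+* Localization.AtPrime 𝔫') = ⊥ :=
      hγΨ.trans (Ideal.span_singleton_eq_bot.mpr rfl)
    have hb' : stalkIdeal K' y' = Ideal.span {0} :=
      ((Ideal.map_eq_bot_iff_of_injective (f := (Ψ : Y'.presheaf.stalk y' →+* Localization.AtPrime 𝔫'))
        (fun a b h => Ψ.injective h)).mp hb).trans (Ideal.span_singleton_eq_bot.mpr rfl).symm
    exact ne_zero_of_mem_singImage_of_stalkIdeal_eq K' hb' hy' rfl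
  have hf₀0 : algebraMap Γ(Y, U) (Localization.AtPrime (U.2.primeIdealOf ⟨y, hyU⟩).asIdeal) F ≠ 0 := by
    intro h0
    apply hγ0
    have h1 := hγ'
    simp only [h0, map_zero, Ideal.span_singleton_zero,
      iSup_colon_singleton_pow_eq_of_isUnit (O := Localization.AtPrime 𝔫') _ hunit, Ideal.span_singleton_eq_bot] at h1
    exact h1
  -- downstairs: `y ∈ singImage X`
  have hgerm := stalkEquiv_algebraMap U hyU F
  have hg0 : (Y.presheaf.germ (U : Y.Opens) y hyU).hom F ≠ 0 := by
    rw [← hgerm]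
    exact fun h => hf₀0 ((stalkEquiv U hyU).injective (h.trans (map_zero _).symm))
  have hysing : y ∈ singImage X := by
    rw [mem_singImage_iff_mem_sq_of_stalkIdeal_eq X (stalkIdeal_eq_span_germ (hy := hyU) X hF) hg0, ← hgerm]
    exact (mem_pow_maximalIdeal_iff_map_ringEquiv (R := Localization.AtPrime (U.2.primeIdealOf ⟨y, hyU⟩).asIdeal)
      (R' := Y.presheaf.stalk y) (stalkEquiv U hyU) _ 2).mp hf₀2
  -- conclude
  calc iotaAt ι K' y' = ι (Localization.AtPrime 𝔫') γ := hιy'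
    _ ≤ ι (Localization.AtPrime (U.2.primeIdealOf ⟨y, hyU⟩).asIdeal)
        (algebraMap Γ(Y, U) (Localization.AtPrime (U.2.primeIdealOf ⟨y, hyU⟩).asIdeal) F) := hle
    _ = iotaAt ι X y := (iotaAt_eq_iota_localization ι (hy := hyU) f hc6 hu X hF).symm
    _ < iotaMax ι X := iotaAt_lt_iotaMax_of_not_mem_maxLocus ι X hysing hy

end Torus

end Summit.ResolutionOfSingularities.ResolutionOfSingularities.Cruxes.HypersurfaceCentreConstruction.LocalEngine
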